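import Summits.BirchSwinnertonDyer.BirchSwinnertonDyer.Theorems.EisensteinPrimesMazurMCOnCellBTwistbackLowerHalf
import Summits.BirchSwinnertonDyer.BirchSwinnertonDyer.Theorems.SchneiderFreeAdditiveX3JointUpperManin
import HarnessLib

/-!
# Crux `MazurMCOnCellB` (stmt-BirchSwinnertonDyer-19033) — the twist-back road with the height REMOVED:
# the rank-one twist's upper half from co-STEP L over a SECOND Heegner field and a twist-unit datum
# (per pair; the additive cell's «twist-unit lever» transplanted to row A10)

LEAD bsd-line-x2-p1 g7 (2026-08-28); companion of p625263 `…TwistbackLowerHalf` (§2 there: Mazur's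
main conjecture at an X2b-type pair `(W, p)` ⇐ STEP L over `K` in the rank-zero orientation +
`Typed.MissingUpperBoundAt Wd p` at the rank-one twist `Wd ≅ E^{(d_K)}`). The remaining twist input —
the UPPER (Euler-system) half of `BSD(p)` at the GV-type rank-one curve `Wd` — was so far fed by a
CYCLOTOMIC package (Greenberg–Vatsal's main conjecture + Schneider's conjecture + the `p`-adic
Gross–Zagier / exceptional leading term: route items 27490, Disegni 2020, `X2.O9.ExceptionalLeadingTermAt`).
THIS FILE feeds it instead from a SECOND imaginary quadratic field `K″` (Heegner for `N(Wd)`, `p` split)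
by the additive cell's kernel lever (`SchneiderFree.Upper.jointUpperBoundAt_of_coStepL_manin`, class-agnostic;
`SchneiderFree.Upper.missingUpperBoundAt_of_jointUpper_of_twistUnit`):

  co-STEP L at `(Wd, K″, P″)` — `IndexUpperBoundLeAt Wd p K″ P″ (v_p c″)`:
  `ord_p #Ш(E^K/K″) + 2·ord_p ∏c(E^K) + 2·v_p(c″) ≤ 2·ord_p [E^K(K″):ℤP″]` (the Kolyvagin direction over `K″`)
  ⟹ the JOINT upper half over `(Wd, W″)`, `W″ ≅ (E^K)^{K″}` of analytic rank ZERO;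
  + a TWIST-UNIT datum `ord_p #Ш_an(W″) ≤ 0` ⟹ `MissingUpperBoundAt Wd p`.

So, PER PAIR: `X2.MazurMainConjectureAt W p` ⇐ STEP L at `(W, K)` [ONE anticyclotomic divisibility, the
Eisenstein-congruence direction] + co-STEP L at `(Wd, K″)` [the OTHER direction, at the twist, over another
field] + ONE unit `#Ш_an` at the rank-zero curve `W″` two quadratic twists away from `W` (`W″` is again an
X2b-type curve: `GVPar` flips twice) + PUB. No `p`-adic height, no Schneider, no exceptional leading term,
no μ-invariant anywhere.

* §1 `mazurMainConjectureAt_of_indexLowerBoundAt_of_jointUpper_of_twistUnit` — the lever in Miller's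
  currency: STEP L at `(W,K,P)` + `JointUpperBoundAt Wd W″ p` + `ord_p #Ш_an(W″) ≤ 0` ⟹ MC at `(W, p)`.
* §2 `mazurMainConjectureAt_of_indexLowerBoundAt_of_coStepL_of_twistUnit` — the same with the joint upper
  half PRODUCED from co-STEP L at an explicit second Heegner datum `(K″, Dt″, H″, P″)` of `Wd` by
  `jointUpperBoundAt_of_coStepL_manin` (Gross–Zagier I.(7.3) for the rank-zero value, the Manin-robust
  index identity, the twist transports at an odd `p ∣ N(Wd)` split in `K″`).
* §3 `mazurMainConjectureAt_transfer_of_jointUpper` — TRANSFER: with the lower half at `W″` in place of the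
  unit (e.g. from Mazur's main conjecture at the X2b-type pair `(W″, p)`), MC passes from `W″` to `W`
  across the biquadratic twist through the GV-type rank-one curve, given the two `K`-halves.

What would discharge the inputs (NOT in print as needed; hypotheses BY NAME): STEP L at `p ‖ N` for
reducible `E[p]` — Keller–Yin Thm. 5.0.4 / Thm. 7.0.6 (PREPRINT) + Castella JIMJ 2018 (`p ≥ 5`), assembled
nowhere; co-STEP L at `p ‖ N` for reducible `E[p]` — a Kolyvagin-type bound over `K″` at an Eisenstein prime
(Lawson–Wuthrich 2016 Thm. 14's reducible case gives `ord_p #Ш(E/K) ≤ 2·ord_p I` under Kolyvagin hygiene,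
CONTESTED by Matar–Nekovář 2019, and without the Tamagawa term, so it serves only when `p ∤ ∏c(E^K)`;
CGLS 2022 §3 / Keller–Yin are the Λ-adic versions, good `p` / PREPRINT); the twist-unit datum — an EXISTENCE
statement («some admissible `K″` has `p ∤ #Ш_an((E^K)^{K″})`»), decidable per pair from exact `L`-values,
open class-wide. Nothing here proves a main conjecture or BSD for any curve. 0 cells / 0 labels / 0 stubs
move; skeleton `mudescent` v4 untouched. No route-file import (the sockets chain of the SchneiderFree route
does not import its `Theses` file either).

References: [JetchevSkinnerWan2017] §7.4.1; [GrossZagier1986] I.(6.3), I.(7.3), V.§2; [LawsonWuthrich2016]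
Thm. 14; [MatarNekovar2019] §0.10–0.11; [KellerYin2024] Thm. D, §7; [Wuthrich2014] Thm. 16;
[Miller2011LMS] Def. 1.1.
-/

set_option autoImplicit false

-- `Summit.BirchSwinnertonDyer.BirchSwinnertonDyer.…`: the summit and its single sub-problem share a name.
set_option linter.dupNamespace false

noncomputable section

open scoped Classical

open WeierstrassCurve NumberField
  Literature.NumberTheory.EllipticCurves
  Literature.NumberTheory.EllipticCurves.ModularForms
  Literature.NumberTheory.EllipticCurves.Rank1Residual
  Literature.NumberTheory.EllipticCurves.Rank1Residual.Typed
  Literature.NumberTheory.EllipticCurves.Wuthrich2014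
  Literature.NumberTheory.EllipticCurves.SteinWuthrich2013
  Summit.BirchSwinnertonDyer.Rank1Residual
  Summit.BirchSwinnertonDyer.BirchSwinnertonDyer.Theorems.EisensteinPrimesMazurMCOnCellBTwistbackLowerHalf
  Summit.BirchSwinnertonDyer.BirchSwinnertonDyer.Theorems.SchneiderFree
  Summit.BirchSwinnertonDyer.BirchSwinnertonDyer.Theorems.SchneiderFree.Upper

namespace Summit.BirchSwinnertonDyer.BirchSwinnertonDyer.Theorems.EisensteinPrimesMazurMCOnCellBTwistbackUnitLever

/-! ## §1. The lever in Miller's currency -/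

/-- **PER PAIR: Mazur's main conjecture at an X2b-type pair from STEP L over `K` (rank-zero orientation),
the JOINT upper half over `(E^K, W″)` and a twist-unit datum at `W″`.** Data as in
`…TwistbackLowerHalf.mazurMainConjectureAt_of_indexLowerBoundAt_of_upper_twist` (`W/ℚ` globally minimal,
`p ≠ 2` multiplicative, `E[p]` reducible, `r_an = 0`; `K` admissible with `d_K` odd `< -4`; `Dt`, `H`, `P`
with `p ∤ c(Dt)`; `Wd` a globally minimal model of `E^{(d_K)}` of analytic rank one), plus ANY Weierstrass
curve `W″/ℚ` with `JointUpperBoundAt Wd W″ p` (`ord_p #Ш(Wd) + ord_p #Ш(W″) ≤ ord_p #Ш_an(Wd) + ord_p #Ш_an(W″)`)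
and `ord_p #Ш_an(W″) ≤ 0`. Then `X2.MazurMainConjectureAt W p`: the lever
`missingUpperBoundAt_of_jointUpper_of_twistUnit` gives the upper half at `Wd`, and p625263 §2 concludes.
[cite: Wuthrich2014, Thm. 16 and §5 (p. 397)] [cite: JetchevSkinnerWan2017, §7.4.1 (eq:shalowerK-1)]
[cite: Miller2011LMS, Def. 1.1] -/
theorem mazurMainConjectureAt_of_indexLowerBoundAt_of_jointUpper_of_twistUnit
    (hWu : thm16_charIdeal_dvd_multiplicative_of_reducible)
    (hJs : thm61_splitMultiplicative) (hJn : thm61_nonsplitMultiplicative)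
    (hHs : exists_isSplitMultCanonical) (hHn : exists_isMultCanonical)
    (hGZK : rank_eq_analyticRank_of_analyticRank_le_one) (hmod : hasEntireLFunction_rat)
    (W : WeierstrassCurve ℚ) [W.IsElliptic] [W.IsGloballyMinimal] (p : ℕ) [Fact p.Prime]
    (hGS : greenberg_stevens (W := W) (p := p))
    (N : ℕ) [NeZero N] (K : Type) [Field K] [NumberField K]
    (Dt : ModularParametrizationData W N) (H : HeegnerDatum N (NumberField.discr K)) (ι : K →+* ℂ)
    (P : (W.baseChange K).toAffine.Point)
    (hGZ : gross_zagier N W K) (hKo : kolyvagin N W K)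
    (hK : IsImaginaryQuadratic K) (hodd : Odd (NumberField.discr K)) (hlt : NumberField.discr K < -4)
    (hN : W.conductorNorm ℤ = N) (hHN : SatisfiesHeegnerHypothesis N K)
    (hHp : SatisfiesHeegnerHypothesis p K)
    (hP : WeierstrassCurve.Affine.Point.map ι.toRatAlgHom P = heegnerPointComplex Dt H)
    (hc : ¬ (p : ℤ) ∣ Dt.c)
    (hp2 : p ≠ 2) (hmult : W.HasMultiplicativeReductionAtPrime p)
    (hred : ¬ W.HasIrreducibleModPGaloisRep p) (hr : W.analyticRank = 0)
    (Wd : WeierstrassCurve ℚ) [Wd.IsElliptic] [Wd.IsGloballyMinimal]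
    (hWd : ∃ C : VariableChange ℚ, C • Wd = W.quadraticTwist (NumberField.discr K : ℚ))
    (hrd : Wd.analyticRank = 1)
    (hlow : Finite (W.baseChange K).sha → X11b.IndexLowerBoundAt W p K P)
    (W'' : WeierstrassCurve ℚ) (hJU : JointUpperBoundAt Wd W'' p)
    (hunit : ∃ s : ℚ, shaAn W'' = (s : ℂ) ∧ padicValRat p s ≤ 0) :
    X2.MazurMainConjectureAt W p :=
  mazurMainConjectureAt_of_indexLowerBoundAt_of_upper_twist hWu hJs hJn hHs hHn hGZK hmod W p hGS N K Dt H ι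
    P hGZ hKo hK hodd hlt hN hHN hHp hP hc hp2 hmult hred hr Wd hWd hrd hlow
    (missingUpperBoundAt_of_jointUpper_of_twistUnit hJU hunit)

/-! ## §2. The joint upper half produced from co-STEP L over a second Heegner field -/

/-- **PER PAIR, TWO HEEGNER FIELDS: Mazur's main conjecture at an X2b-type pair from STEP L at `(W, K)`,
co-STEP L at `(Wd, K″)` and a twist-unit datum.** On top of §1's data: the conductor `N″` of `Wd`
(`p ∣ N″`), an imaginary quadratic `K″` with `d_{K″}` odd, `p ∤ w_{K″}`, Heegner for `N″` (so `p` splits in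
`K″`), `L((E^K)^{(d_{K″})}, 1) ≠ 0`, a parametrisation datum `Dt″` of `Wd`, Heegner datum `H″`, Heegner point
`P″ ∈ E^K(K″)`, a globally minimal model `W″` of `(E^K)^{(d_{K″})}`; hypotheses BY NAME: STEP L at `(W,K,P)`,
co-STEP L `IndexUpperBoundLeAt Wd p K″ P″ (v_p c(Dt″))` and `ord_p #Ш_an(W″) ≤ 0`; published binders incl.
Gross–Zagier I.(7.3) (`hGZ73`). Proof: `SchneiderFree.Upper.jointUpperBoundAt_of_coStepL_manin` at
`(Wd, K″)` (rank-one orientation, `p ∣ N(Wd)`), then §1. [cite: GrossZagier1986, Thm. I.(6.3) and (7.3)]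
[cite: JetchevSkinnerWan2017, §7.4.1 (arXiv:1512.06894 p. 30)] [cite: Wuthrich2014, Thm. 16 (p. 397)]
[cite: LawsonWuthrich2016, Thm. 14 (what hco would need at a reducible prime; hypothesis)] -/
theorem mazurMainConjectureAt_of_indexLowerBoundAt_of_coStepL_of_twistUnit
    (hWu : thm16_charIdeal_dvd_multiplicative_of_reducible)
    (hJs : thm61_splitMultiplicative) (hJn : thm61_nonsplitMultiplicative)
    (hHs : exists_isSplitMultCanonical) (hHn : exists_isMultCanonical)
    (hGZK : rank_eq_analyticRank_of_analyticRank_le_one) (hmod : hasEntireLFunction_rat)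
    (hGZall : ∀ (N : ℕ) [NeZero N] (W : WeierstrassCurve ℚ) (K : Type) [Field K] [NumberField K],
      gross_zagier N W K)
    (hKoall : ∀ (N : ℕ) [NeZero N] (W : WeierstrassCurve ℚ) (K : Type) [Field K] [NumberField K],
      kolyvagin N W K)
    (hGZ73 : GrossZagier1986_thm_I_7_3)
    (W : WeierstrassCurve ℚ) [W.IsElliptic] [W.IsGloballyMinimal] (p : ℕ) [Fact p.Prime]
    (hGS : greenberg_stevens (W := W) (p := p))
    (N : ℕ) [NeZero N] (K : Type) [Field K] [NumberField K]
    (Dt : ModularParametrizationData W N) (H : HeegnerDatum N (NumberField.discr K)) (ι : K →+* ℂ)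
    (P : (W.baseChange K).toAffine.Point)
    (hK : IsImaginaryQuadratic K) (hodd : Odd (NumberField.discr K)) (hlt : NumberField.discr K < -4)
    (hN : W.conductorNorm ℤ = N) (hHN : SatisfiesHeegnerHypothesis N K)
    (hHp : SatisfiesHeegnerHypothesis p K)
    (hP : WeierstrassCurve.Affine.Point.map ι.toRatAlgHom P = heegnerPointComplex Dt H)
    (hc : ¬ (p : ℤ) ∣ Dt.c)
    (hp2 : p ≠ 2) (hmult : W.HasMultiplicativeReductionAtPrime p)
    (hred : ¬ W.HasIrreducibleModPGaloisRep p) (hr : W.analyticRank = 0)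
    (Wd : WeierstrassCurve ℚ) [Wd.IsElliptic] [Wd.IsGloballyMinimal]
    (hWd : ∃ C : VariableChange ℚ, C • Wd = W.quadraticTwist (NumberField.discr K : ℚ))
    (hrd : Wd.analyticRank = 1)
    (hlow : Finite (W.baseChange K).sha → X11b.IndexLowerBoundAt W p K P)
    -- the second Heegner field, for the twist
    (N'' : ℕ) [NeZero N''] (K'' : Type) [Field K''] [NumberField K'']
    (Dt'' : ModularParametrizationData Wd N'') (H'' : HeegnerDatum N'' (NumberField.discr K''))
    (ι'' : K'' →+* ℂ) (P'' : (Wd.baseChange K'').toAffine.Point)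
    (W'' : WeierstrassCurve ℚ) [W''.IsElliptic] [W''.IsGloballyMinimal]
    (hN'' : Wd.conductorNorm ℤ = N'') (hK'' : IsImaginaryQuadratic K'') (hodd'' : Odd (NumberField.discr K''))
    (hw'' : ¬ p ∣ Units.torsionOrder K'') (hHN'' : SatisfiesHeegnerHypothesis N'' K'')
    (hLd'' : (Wd.quadraticTwist (NumberField.discr K'' : ℚ)).entireLFunction 1 ≠ 0)
    (hP'' : WeierstrassCurve.Affine.Point.map ι''.toRatAlgHom P'' = heegnerPointComplex Dt'' H'')
    (hC'' : ∃ C : VariableChange ℚ, C • Wd.quadraticTwist (NumberField.discr K'' : ℚ) = W'')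
    (hco : IndexUpperBoundLeAt Wd p K'' P'' (padicValNat p Dt''.c.natAbs))
    (hunit : ∃ s : ℚ, shaAn W'' = (s : ℂ) ∧ padicValRat p s ≤ 0) :
    X2.MazurMainConjectureAt W p := by
  have hpP : p.Prime := Fact.out
  -- `p ∣ N(Wd)`: the twist is multiplicative at `p` (`p` unramified in `K`)
  obtain ⟨C, hC⟩ := hWd
  have hXd : ClassX2 Wd p := X2.classX2_twist W p ⟨hp2, hred, hmult⟩ K hK hHp Wd ⟨C, hC⟩
  have hN0 : Wd.conductorNorm ℤ ≠ 0 := (Wd.conductorNorm_pos_holds).ne'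
  have hfac := Wd.factorization_conductorNorm_eq_one_of_hasMultiplicativeReductionAtPrime p hXd.2.2
  have hpNd : p ∣ Wd.conductorNorm ℤ := (hpP.dvd_iff_one_le_factorization hN0).mpr hfac.ge
  have hJU : JointUpperBoundAt Wd W'' p :=
    jointUpperBoundAt_of_coStepL_manin hGZall hKoall hGZK hmod hGZ73 Wd p N'' K'' Dt'' H'' ι'' P'' W'' hrd
      hN'' (hN'' ▸ hpNd) hK'' hodd'' hw'' hHN'' hLd'' hP'' hC'' hp2 hco
  exact mazurMainConjectureAt_of_indexLowerBoundAt_of_jointUpper_of_twistUnit hWu hJs hJn hHs hHn hGZK hmod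
    W p hGS N K Dt H ι P (hGZall N W K) (hKoall N W K) hK hodd hlt hN hHN hHp hP hc hp2 hmult hred hr Wd
    ⟨C, hC⟩ hrd hlow W'' hJU hunit

/-! ## §3. Transfer of the main conjecture across the biquadratic twist -/

/-- **TRANSFER: the LOWER half at `W″` in place of the unit.** With §1's data, `JointUpperBoundAt Wd W″ p`
and `Typed.MissingLowerBoundAt W″ p` give the upper half at `Wd`
(`missingUpperBoundAt_of_jointUpper_of_lower`), hence Mazur's main conjecture at `(W, p)`. When `W″` is
itself an X2b-type pair of analytic rank zero, its lower half IS its main conjecture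
(`X2.mazurMainConjectureAt_iff_missingLowerBoundAt_of_red`): the main conjecture PROPAGATES from `W″` to
`W` through the GV-type rank-one curve `E^K`, given STEP L at `(W, K)` and the joint upper half (co-STEP L)
at `(E^K, K″)`. [cite: Wuthrich2014, Thm. 16 (p. 397)] [cite: Miller2011LMS, Def. 1.1]
[cite: JetchevSkinnerWan2017, §7.4.1 (eq:shalowerK-1)] -/
theorem mazurMainConjectureAt_transfer_of_jointUpper
    (hWu : thm16_charIdeal_dvd_multiplicative_of_reducible)
    (hJs : thm61_splitMultiplicative) (hJn : thm61_nonsplitMultiplicative)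
    (hHs : exists_isSplitMultCanonical) (hHn : exists_isMultCanonical)
    (hGZK : rank_eq_analyticRank_of_analyticRank_le_one) (hmod : hasEntireLFunction_rat)
    (W : WeierstrassCurve ℚ) [W.IsElliptic] [W.IsGloballyMinimal] (p : ℕ) [Fact p.Prime]
    (hGS : greenberg_stevens (W := W) (p := p))
    (N : ℕ) [NeZero N] (K : Type) [Field K] [NumberField K]
    (Dt : ModularParametrizationData W N) (H : HeegnerDatum N (NumberField.discr K)) (ι : K →+* ℂ)
    (P : (W.baseChange K).toAffine.Point)
    (hGZ : gross_zagier N W K) (hKo : kolyvagin N W K)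
    (hK : IsImaginaryQuadratic K) (hodd : Odd (NumberField.discr K)) (hlt : NumberField.discr K < -4)
    (hN : W.conductorNorm ℤ = N) (hHN : SatisfiesHeegnerHypothesis N K)
    (hHp : SatisfiesHeegnerHypothesis p K)
    (hP : WeierstrassCurve.Affine.Point.map ι.toRatAlgHom P = heegnerPointComplex Dt H)
    (hc : ¬ (p : ℤ) ∣ Dt.c)
    (hp2 : p ≠ 2) (hmult : W.HasMultiplicativeReductionAtPrime p)
    (hred : ¬ W.HasIrreducibleModPGaloisRep p) (hr : W.analyticRank = 0)
    (Wd : WeierstrassCurve ℚ) [Wd.IsElliptic] [Wd.IsGloballyMinimal]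
    (hWd : ∃ C : VariableChange ℚ, C • Wd = W.quadraticTwist (NumberField.discr K : ℚ))
    (hrd : Wd.analyticRank = 1)
    (hlow : Finite (W.baseChange K).sha → X11b.IndexLowerBoundAt W p K P)
    (W'' : WeierstrassCurve ℚ) (hJU : JointUpperBoundAt Wd W'' p) (hL'' : MissingLowerBoundAt W'' p) :
    X2.MazurMainConjectureAt W p :=
  mazurMainConjectureAt_of_indexLowerBoundAt_of_upper_twist hWu hJs hJn hHs hHn hGZK hmod W p hGS N K Dt H ι
    P hGZ hKo hK hodd hlt hN hHN hHp hP hc hp2 hmult hred hr Wd hWd hrd hlow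
    (missingUpperBoundAt_of_jointUpper_of_lower hJU hL'')

/-- **TRANSFER from the main conjecture at the far twist.** If `W″` is an odd multiplicative reducible
rank-zero pair at `p` (an X2a/X2b-type pair) where Mazur's main conjecture holds, then — given §1's data,
STEP L at `(W, K)` and the joint upper half over `(E^K, W″)` — it holds at `(W, p)`: the main conjecture at
`W″` is `BSD(W″, p)` (`X2.bsdp_of_mazurMainConjectureAt_of_analyticRank_eq_zero`, modular parametrisation
`hpar`), whose lower half feeds `mazurMainConjectureAt_transfer_of_jointUpper`. In particular every X2b-type
curve two admissible quadratic twists away from a pair with `p ∤ #Ш_an` (closed in print, Wuthrich Prop. 21)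
inherits the main conjecture modulo the two `K`-halves. [cite: Wuthrich2014, Thm. 16 (p. 397) and Prop. 21 (p. 400)]
[cite: SteinWuthrich2013, Thm. 6.1 (p. 20)] [cite: Miller2011LMS, Def. 1.1] -/
theorem mazurMainConjectureAt_transfer_of_mazurMainConjectureAt
    (hWu : thm16_charIdeal_dvd_multiplicative_of_reducible)
    (hJs : thm61_splitMultiplicative) (hJn : thm61_nonsplitMultiplicative)
    (hHs : exists_isSplitMultCanonical) (hHn : exists_isMultCanonical)
    (hGZK : rank_eq_analyticRank_of_analyticRank_le_one) (hmod : hasEntireLFunction_rat)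
    (hpar : nonempty_modularParametrizationData)
    (W : WeierstrassCurve ℚ) [W.IsElliptic] [W.IsGloballyMinimal] (p : ℕ) [Fact p.Prime]
    (hGSall : ∀ (W : WeierstrassCurve ℚ) [W.IsElliptic] [W.IsGloballyMinimal] (p : ℕ) [Fact p.Prime],
      greenberg_stevens (W := W) (p := p))
    (N : ℕ) [NeZero N] (K : Type) [Field K] [NumberField K]
    (Dt : ModularParametrizationData W N) (H : HeegnerDatum N (NumberField.discr K)) (ι : K →+* ℂ)
    (P : (W.baseChange K).toAffine.Point)
    (hGZ : gross_zagier N W K) (hKo : kolyvagin N W K)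
    (hK : IsImaginaryQuadratic K) (hodd : Odd (NumberField.discr K)) (hlt : NumberField.discr K < -4)
    (hN : W.conductorNorm ℤ = N) (hHN : SatisfiesHeegnerHypothesis N K)
    (hHp : SatisfiesHeegnerHypothesis p K)
    (hP : WeierstrassCurve.Affine.Point.map ι.toRatAlgHom P = heegnerPointComplex Dt H)
    (hc : ¬ (p : ℤ) ∣ Dt.c)
    (hp2 : p ≠ 2) (hmult : W.HasMultiplicativeReductionAtPrime p)
    (hred : ¬ W.HasIrreducibleModPGaloisRep p) (hr : W.analyticRank = 0)
    (Wd : WeierstrassCurve ℚ) [Wd.IsElliptic] [Wd.IsGloballyMinimal]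
    (hWd : ∃ C : VariableChange ℚ, C • Wd = W.quadraticTwist (NumberField.discr K : ℚ))
    (hrd : Wd.analyticRank = 1)
    (hlow : Finite (W.baseChange K).sha → X11b.IndexLowerBoundAt W p K P)
    (W'' : WeierstrassCurve ℚ) [W''.IsElliptic] [W''.IsGloballyMinimal] (hJU : JointUpperBoundAt Wd W'' p)
    (hmult'' : W''.HasMultiplicativeReductionAtPrime p) (hr'' : W''.analyticRank = 0)
    (hMC'' : X2.MazurMainConjectureAt W'' p) :
    X2.MazurMainConjectureAt W p := by
  have hbsd'' : BSDp W'' p :=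
    X2.bsdp_of_mazurMainConjectureAt_of_analyticRank_eq_zero hJs hJn hHs hHn hGZK hmod hpar W'' p (hGSall W'' p)
      hp2 hmult'' hr'' hMC''
  haveI : Finite W''.sha := (hGZK W'' (by rw [hr'']; exact zero_le_one)).2
  have hL'' : MissingLowerBoundAt W'' p :=
    (lower_and_upper_of_missingPPartAt W'' p (missingPPartAt_of_bsdp W'' p hbsd'')).1
  exact mazurMainConjectureAt_transfer_of_jointUpper hWu hJs hJn hHs hHn hGZK hmod W p (hGSall W p) N K Dt H ι P
    hGZ hKo hK hodd hlt hN hHN hHp hP hc hp2 hmult hred hr Wd hWd hrd hlow W'' hJU hL''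

end Summit.BirchSwinnertonDyer.BirchSwinnertonDyer.Theorems.EisensteinPrimesMazurMCOnCellBTwistbackUnitLever

end
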